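import Summits.CriticalPhenomena.PercolationContinuityZ3.Theorems.SahiMasterFamilyTriangle
import Summits.CriticalPhenomena.PercolationContinuityZ3.Theorems.SahiMasterFamilyEqPrincipal

/-!
# The terminal class of (T): preliminaries (triangle, cylinders)

Companion of `SahiMasterFamilyTriangle.lean` / `SahiMasterFamilyL3.lean` (unit `prim-master-conj`; final assembly of the terminal analysis of (T)).
Preliminaries: the top Möbius coefficient of `{a ∨ b}` is `−1` (`mobCoeff_orPair`); a pure event is the cylinder on its
essential support (`eq_cylinder_of_pure`); pairwise-dependent triples with a cylinder slot have `E_3(μ_p) ≠ 0` at every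
interior `p` (`sahiE_three_ne_zero_of_cylinder`, by the tree's unconditional (EQ-3) on the principal stratum
`sahiE_three_ind_eq_zero_iff_of_cylinder` after a permutation of the slots); the triangle has `E_3 ≢ 0`
(`sahiE_three_ne_zero_of_triangle`, top monomial); a saturating shared coordinate produces the triangle
(`triangle_of_saturation`, NS + SS).  Everything here is proved; axioms standard. [this work]
-/

noncomputable section

open scoped Classical

namespace Summit.CriticalPhenomena.PercolationContinuityZ3.Theorems

open Finset Function
open Literature.Combinatorics.Sahi2008
open Literature.Probability.Percolation (DeterminedBy determinedBy_iff)
open Literature.Probability.Percolation.DecisionTree (ind ind_of_mem ind_of_not_mem ind_nonneg)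
open Literature.Probability.LatticeModels.Kahn2022 (Affects)

variable {ι : Type*} [Fintype ι]

/-! ### The top Möbius coefficient of `{a ∨ b}` -/

/-- `ĉ_{{a,b}}(1_{a∨b}) = −1`. [this work] -/
theorem mobCoeff_orPair {a b : ι} (hab : a ≠ b) : mobCoeff (ind (orPair a b)) ({a, b} : Finset ι) = -1 := by
  unfold mobCoeff
  -- only the four subsets of `{a, b}` contribute
  have hsub : ∀ ω : Set ι, ω ⊆ ↑({a, b} : Finset ι) →
      ω = ∅ ∨ ω = {a} ∨ ω = {b} ∨ ω = {a, b} := by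
    intro ω hω
    by_cases ha : a ∈ ω <;> by_cases hb : b ∈ ω
    · right; right; right
      ext i; constructor
      · intro hi; have := hω hi; simpa using this
      · rintro (rfl | rfl) <;> assumption
    · right; left
      ext i; constructor
      · intro hi
        have := hω hi
        simp only [coe_insert, coe_singleton, Set.mem_insert_iff, Set.mem_singleton_iff] at this
        rcases this with rfl | rfl
        · rfl
        · exact absurd hi hb
      · rintro rfl; exact ha
    · right; right; left
      ext i; constructor
      · intro hi
        have := hω hi
        simp only [coe_insert, coe_singleton, Set.mem_insert_iff, Set.mem_singleton_iff] at this
        rcases this with rfl | rfl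
        · exact absurd hi ha
        · rfl
      · rintro rfl; exact hb
    · left
      ext i; constructor
      · intro hi
        have := hω hi
        simp only [coe_insert, coe_singleton, Set.mem_insert_iff, Set.mem_singleton_iff] at this
        rcases this with rfl | rfl
        · exact absurd hi ha
        · exact absurd hi hb
      · intro hi; exact absurd hi (Set.notMem_empty i)
  set F : Set ι → ℝ := fun ω =>
    if ω ⊆ ↑({a, b} : Finset ι) then moebSign ({a, b} : Finset ι) ω * ind (orPair a b) ω else 0 with hF
  have hsupp : ∀ ω ∈ (univ : Finset (Set ι)), ω ∉ ({∅, {a}, {b}, {a, b}} : Finset (Set ι)) → F ω = 0 := by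
    intro ω _ hω
    simp only [hF]
    split_ifs with h
    · exfalso; apply hω
      rcases hsub ω h with rfl | rfl | rfl | rfl <;> simp
    · rfl
  rw [← Finset.sum_subset (Finset.subset_univ _) hsupp]
  have hne1 : (∅ : Set ι) ∉ ({{a}, {b}, {a, b}} : Finset (Set ι)) := by
    simp only [Finset.mem_insert, Finset.mem_singleton, not_or]
    refine ⟨fun h => ?_, fun h => ?_, fun h => ?_⟩
    · exact (Set.singleton_ne_empty a) h.symm
    · exact (Set.singleton_ne_empty b) h.symm
    · have : a ∈ (∅ : Set ι) := by rw [h]; exact Set.mem_insert a _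
      exact this
  have hne2 : ({a} : Set ι) ∉ ({{b}, {a, b}} : Finset (Set ι)) := by
    simp only [Finset.mem_insert, Finset.mem_singleton, not_or]
    refine ⟨fun h => hab (Set.singleton_eq_singleton_iff.1 h), fun h => ?_⟩
    have : b ∈ ({a} : Set ι) := by rw [h]; exact Set.mem_insert_of_mem a rfl
    exact hab (Set.mem_singleton_iff.1 this).symm
  have hne3 : ({b} : Set ι) ∉ ({{a, b}} : Finset (Set ι)) := by
    simp only [Finset.mem_singleton]
    intro h
    have : a ∈ ({b} : Set ι) := by rw [h]; exact Set.mem_insert a _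
    exact hab (Set.mem_singleton_iff.1 this)
  rw [Finset.sum_insert hne1, Finset.sum_insert hne2, Finset.sum_insert hne3, Finset.sum_singleton]
  -- evaluate the four terms
  have hT : ∀ ω : Set ι, ω = ∅ ∨ ω = {a} ∨ ω = {b} ∨ ω = {a, b} → ω ⊆ ↑({a, b} : Finset ι) := by
    rintro ω (rfl | rfl | rfl | rfl)
    · exact Set.empty_subset _
    · simp
    · simp
    · simp
  have sgn : ∀ ω : Set ι, moebSign ({a, b} : Finset ι) ω =
      (if a ∈ ω then (1 : ℝ) else -1) * (if b ∈ ω then (1 : ℝ) else -1) := by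
    intro ω
    simp only [moebSign]
    rw [Finset.prod_insert (show a ∉ ({b} : Finset ι) by simpa using hab), Finset.prod_singleton]
  simp only [hF, hT _ (Or.inl rfl), hT _ (Or.inr (Or.inl rfl)), hT _ (Or.inr (Or.inr (Or.inl rfl))),
    hT _ (Or.inr (Or.inr (Or.inr rfl))), if_true, sgn]
  have i0 : ind (orPair a b) (∅ : Set ι) = 0 := ind_of_not_mem (by simp [orPair])
  have ia : ind (orPair a b) ({a} : Set ι) = 1 := ind_of_mem (by simp [orPair])
  have ib : ind (orPair a b) ({b} : Set ι) = 1 := ind_of_mem (by simp [orPair])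
  have iab : ind (orPair a b) ({a, b} : Set ι) = 1 := ind_of_mem (by simp [orPair])
  rw [i0, ia, ib, iab]
  simp [hab, Ne.symm hab]

/-! ### Pure events are cylinders -/

/-- A nonempty increasing event all of whose essential coordinates are mandatory is the cylinder on its essential
support. [this work] -/
theorem eq_cylinder_of_pure {X : Set (Set ι)} (hX : IsUpperSet X) (hne : X.Nonempty)
    (hpure : ∀ f ∈ esupp X, secAt f false X = ∅) : X = {ω | (↑(esupp X) : Set ι) ⊆ ω} := by
  ext ω
  constructor
  · intro hω f hf
    by_contra hfω
    have : ω ∈ secAt f false X := (mem_secAt_false_iff_of_notMem hfω).2 hω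
    rw [hpure f hf] at this
    exact this
  · exact fun h => mem_of_esupp_subset hX hne h

/-! ### Non-vanishing for triples with a cylinder slot, and for the triangle -/

/-- `E_3` is symmetric in the three events. [folklore] -/
theorem sahiE_three_ind_perm (μ : Set ι → ℝ) (U : Fin 3 → Set (Set ι)) (σ : Equiv.Perm (Fin 3)) :
    sahiE μ 3 (fun j => ind (U (σ j))) = sahiE μ 3 (fun j => ind (U j)) :=
  sahiE_comp_perm μ 3 σ (fun j => ind (U j))

/-- A `Z_3`-family has two members with disjoint essential supports. [this work] -/
theorem exists_disjoint_of_suppZeroFlag_three {U : Fin 3 → Set (Set ι)} (hU : ∀ j, IsUpperSet (U j))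
    (h : SuppZeroFlag 3 U) : ∃ a b : Fin 3, a ≠ b ∧ Disjoint (esupp (U a)) (esupp (U b)) := by
  obtain ⟨m, hm, -⟩ := h
  rw [suppZeroFlag_two_eta] at hm
  refine ⟨m.succAbove 0, m.succAbove 1, fun h => ?_, (suppZeroFlag_two_iff (hU _) (hU _)).1 hm⟩
  exact absurd (Fin.succAbove_right_injective h) (by decide)

/-- **Pairwise-dependent triples with a cylinder slot have `E_3(μ_p) ≠ 0` at every interior `p`** (the tree's
unconditional (EQ-3) on the principal stratum, `sahiE_three_ind_eq_zero_iff_of_cylinder`, after a permutation).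
[this work] -/
theorem sahiE_three_ne_zero_of_cylinder {ι : Type} [Fintype ι] {U : Fin 3 → Set (Set ι)} (hU : ∀ j, IsUpperSet (U j))
    (hpair : ∀ a b : Fin 3, a ≠ b → (esupp (U a) ∩ esupp (U b)).Nonempty) (j : Fin 3) (S : Set ι)
    (hS : U j = {ω | S ⊆ ω}) (p : ι → unitInterval) (hp : ∀ e, (p e : ℝ) ∈ Set.Ioo (0 : ℝ) 1) :
    sahiE (bernoulliWeight p) 3 (fun i => ind (U i)) ≠ 0 := by
  intro h0
  set σ : Equiv.Perm (Fin 3) := Equiv.swap j 2 with hσ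
  set U' : Fin 3 → Set (Set ι) := fun i => U (σ i) with hU'
  have hU'up : ∀ i, IsUpperSet (U' i) := fun i => hU _
  have h0' : sahiE (bernoulliWeight p) 3 (fun i => ind (U' i)) = 0 := by
    rw [hU', sahiE_three_ind_perm]; exact h0
  have h2 : U' 2 = {ω | S ⊆ ω} := by simp [hU', hσ, Equiv.swap_apply_right, hS]
  have hZ := (sahiE_three_ind_eq_zero_iff_of_cylinder p hp U' hU'up S h2).1 h0'
  obtain ⟨a, b, hab, hd⟩ := exists_disjoint_of_suppZeroFlag_three hU'up hZ
  have hne := hpair (σ a) (σ b) (fun h => hab (σ.injective h))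
  exact Finset.not_disjoint_iff_nonempty_inter.2 hne hd

/-- **The triangle has `E_3 ≢ 0`**: if every event is `{x ∨ y}` with essential support `{x, y}` and the supports
pairwise intersect, some interior `p` has `E_3(μ_p) ≠ 0` (top Möbius coefficients `−1`). [this work] -/
theorem sahiE_three_ne_zero_of_triangle {ι : Type} [Fintype ι] {U : Fin 3 → Set (Set ι)} (hU : ∀ j, IsUpperSet (U j))
    (hpair : ∀ a b : Fin 3, a ≠ b → (esupp (U a) ∩ esupp (U b)).Nonempty)
    (htri : ∀ j, ∃ x y : ι, x ≠ y ∧ U j = orPair x y ∧ esupp (U j) = {x, y}) :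
    ∃ p : ι → unitInterval, (∀ e, (p e : ℝ) ∈ Set.Ioo (0 : ℝ) 1) ∧
      sahiE (bernoulliWeight p) 3 (fun j => ind (U j)) ≠ 0 := by
  refine sahiE3Nonvanishing_of_mobCoeff U (fun j => esupp (U j)) (fun j => determinedBy_esupp (hU j))
    (hpair 0 1 (by decide)) (hpair 0 2 (by decide)) (hpair 1 2 (by decide)) fun j => ?_
  obtain ⟨x, y, hxy, hUj, hes⟩ := htri j
  rw [hes, hUj, mobCoeff_orPair hxy]
  norm_num

/-! ### The triangle from a saturating coordinate -/

/-- A saturating shared coordinate produces the triangle (NS + SS). [this work] -/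
theorem triangle_of_saturation {X Y Z : Set (Set ι)} (hX : IsUpperSet X) (hY : IsUpperSet Y) (hZ : IsUpperSet Z)
    (hXZ : (esupp X ∩ esupp Z).Nonempty) (hYZ : (esupp Y ∩ esupp Z).Nonempty)
    (hprivX : esupp X ⊆ esupp Y ∪ esupp Z) (hprivY : esupp Y ⊆ esupp X ∪ esupp Z)
    (hprivZ : esupp Z ⊆ esupp X ∪ esupp Y) (hcommon : ∀ i, i ∈ esupp X → i ∈ esupp Y → i ∉ esupp Z)
    (hmin : ∀ i ∈ esupp X ∪ esupp Y ∪ esupp Z, ∀ b : Bool, SuppZeroFlag 3 ![secAt i b X, secAt i b Y, secAt i b Z])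
    {f : ι} (hfX : f ∈ esupp X) (hfY : f ∈ esupp Y) (hsat : secAt f true X = Set.univ) :
    ∃ s t : ι, esupp X = {f, s} ∧ esupp Y = {f, t} ∧ esupp Z = {s, t} ∧
      X = orPair f s ∧ Y = orPair f t ∧ Z = orPair s t := by
  have hfZ : f ∉ esupp Z := hcommon f hfX hfY
  have hfW : f ∈ esupp X ∪ esupp Y ∪ esupp Z := by simp [hfX]
  obtain ⟨hX0, hY0, hsatY⟩ := saturates_both_of_saturates hX hY hZ hXZ hYZ hprivY hfZ hsat (hmin f hfW true)
    (hmin f hfW false)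
  exact lemma_SS hX hY hZ hXZ hYZ hprivX hprivY hprivZ hcommon hmin hfX hfY hX0 hY0 hsat hsatY


end Summit.CriticalPhenomena.PercolationContinuityZ3.Theorems
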